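import Summits.BirchSwinnertonDyer.BirchSwinnertonDyer.Theorems.ByReductionTypeAtTwoSupersingularUnitAnchorTP2Items
import HarnessLib

/-!
# Crux `SupersingularRankZeroAtTwo` (item stmt-BirchSwinnertonDyer-19097, route `ByReductionTypeAtTwo`, rung K4): the UNIT-ANCHOR road —
# the KATO / MILLER UPPER HALF `MissingUpperBoundAt W 2` from ONLY TWO route-TP2 items BY NAME (K3 20308, K4 20309), the anchor and the
# `μ`-transport in the kernel — NO `λ`, NO layer certificate, NO item 23110 (seat `bsd-2adic-ss-1x` GEN 7; companion of `…UnitAnchorTP2Items` p594478)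

HONEST FRAMING (cells `bsd-2adic` / `bsd-wall`; HUMAN RULINGS D-0036/D-0054/D-0074): THEOREMS ONLY — no definition, no named fact, no instance, no `sorry`;
TWO hypotheses are OPEN items of route `ThetaPartnerAtTwo` taken BY NAME at the curve `W` — K3 `SignedKatoDivisibilityUpToAtTwo` (20308) and K4
`SignedControlAtTwo` (20309); they are NOT proved here; closes no item; a HALF of BSD₂ (`MissingUpperBoundAt`, Miller's upper bound `ord₂ #Ш ≤ ord₂ #Ш_an`),
not BSD₂; BSD is NOT proved by any of this. PARTITION (D-0054): X5@2 good-ss `a₂ = 0` UNIT-ANCHOR sub-row (the 12 rank-`0` classes with `Δ_E < 0`) × `p = 2` —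
types-the-object-of; bears_on K4 19097 · TP2 20308 · 20309.

WHAT. The full display `SSUnitAnchor.kobayashiMainConjecture_and_bsdp_two_of_unitAnchor_of_TP2Items` (p594478) consumes THREE TP2 items: K3, K4 and RLF⁻ 23110,
the last one only to pin `λ(X⁺_W)` against the layer certificate (exactness of the main conjecture). The UPPER half needs no `λ` at all: GEN 4's
`signedUpperDivisibility_two_of_katoUpTo_of_mu_eq_zero` (p558810) turns K3's divisibility UP TO `2^m` into the exact upper divisibility `char X⁺_W ∣ ϖ L♭_W` as soon
as every signed dual datum of `W` is torsion with `μ = 0` — which the anchor delivers IN THE KERNEL (`anchorPackage_of_unitZone` p593535: `X⁺_A = 0`; CM-free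
transport `SignedTransportAtTwo.TwoCongruence.isTorsion_and_mu_eq_zero_of_twoCongruence_negDisc` p588269) — and lane A's
`missingUpperBoundAt_two_of_signedUpperDivisibility_two` closes with K4's Kim term. Displayed: PUB {`hmod`, `hGZK`, `h2`}; ITEMS {`hK3`, `hK4`}; CERT {`hAr`/`hLA`,
`hTam`, `hSha`}; KERNEL {anchor package, transport, `Δ_W < 0`, `e : W[2] ≃ A[2]`}.
* `SSUnitAnchor.missingUpperBoundAt_two_of_unitAnchor_of_K3K4` — the pair door;
* `SSUnitAnchor.missingUpperBoundAt_two_baseChange_int_of_unitAnchor_of_K3K4` — kit twin on integer models (Tschirnhaus pair).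

References: [Kobayashi2003] Thm. 1.2, 4.1, §8.4, 9.3; [GreenbergLNM1716] §3 Prop. 3.8; [Kato2004Asterisque] Thm. 12.4–12.5 (3); [BDKim2013] Cor. 3.15;
[BDKim2009] Cor. 2.13; [AbbesUllmo1996] Thm. A; [Washington1997] §7.1, §13.2; [Miller2011LMS] Def. 1.1.
-/

set_option autoImplicit false
-- the Theorems namespace of this sub repeats the summit name by design (D-0017 nested layout)
set_option linter.dupNamespace false

noncomputable section

open scoped Classical MatrixGroups ModularForm NumberField

open CongruenceSubgroup Polynomial WeierstrassCurve NumberField IsDedekindDomain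
  Literature.NumberTheory.EllipticCurves
  Literature.NumberTheory.EllipticCurves.ModularForms Literature.NumberTheory.EllipticCurves.Sprung2017
  Literature.NumberTheory.EllipticCurves.Rank1Residual Literature.NumberTheory.EllipticCurves.Rank1Residual.Typed
  Literature.NumberTheory.EllipticCurves.Kobayashi2003 Literature.NumberTheory.EllipticCurves.IwasawaDual
  Literature.NumberTheory.IwasawaTheory
  ZpExtension Summit.BirchSwinnertonDyer.Rank1Residual Summit.BirchSwinnertonDyer.Rank1Residual.Supersingular
  Summit.BirchSwinnertonDyer.Rank1Residual.X5.O1 Summit.BirchSwinnertonDyer.Rank1Residual.X1.MuLambda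
  Summit.BirchSwinnertonDyer.BirchSwinnertonDyer.Theses.ThetaPartnerAtTwo

namespace Summit.BirchSwinnertonDyer.BirchSwinnertonDyer.Theorems
namespace SSUnitAnchor

/-! ## §1 The pair door for the upper half -/

section Pair

variable (W : WeierstrassCurve ℚ) [W.IsElliptic] [W.IsGloballyMinimal]
  (A : WeierstrassCurve ℚ) [A.IsElliptic] [A.IsGloballyMinimal]

/-- **Torsion and `μ⁺ = 0` at `W` from a unit-zone anchor, IN THE KERNEL.** `W` good supersingular at `2` with `a₂ = 0`, `Δ_W < 0`; `A` good ss at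
`2` with `a₂ = 0`, of analytic rank `0`, `2 ∤ ∏c_ℓ(A)`, `2 ∤ #Ш(A)`; an equivariant `e : W[2] ≃ A[2]`. Then EVERY plus signed dual datum of `W` over the
cyclotomic tower is `Λ`-torsion with `μ = 0`: `X⁺_A = 0` (`anchorPackage_of_unitZone`) transported along `e`
(`SignedTransportAtTwo.TwoCongruence.isTorsion_and_mu_eq_zero_of_twoCongruence_negDisc`). No research input. [cite: BDKim2009, Cor. 2.13]
[cite: GreenbergVatsal2000, Thm. (1.4)] [cite: GreenbergLNM1716, §3 Prop. 3.8] [cite: Kobayashi2003, §8.4 and Thm. 9.3] -/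
theorem isTorsion_and_mu_eq_zero_of_unitAnchor (hGZK : rank_eq_analyticRank_of_analyticRank_le_one)
    (hss : GoodSS W 2) (ha : W.frobeniusTrace 2 = 0) (hΔ : W.Δ < 0)
    (hAr : A.analyticRank = 0) (hAss : GoodSS A 2) (hAa : A.frobeniusTrace 2 = 0)
    (hTam : ¬ 2 ∣ A.tamagawaProduct) (hSha : ¬ 2 ∣ A.shaOrder)
    (e : WeierstrassCurve.geomTorsion W (2 : ℤ) ≃+ WeierstrassCurve.geomTorsion A (2 : ℤ))
    (he : ∀ (σ : Field.absoluteGaloisGroup ℚ) (P : WeierstrassCurve.geomTorsion W (2 : ℤ)), e (σ • P) = σ • e P) :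
    ∀ (κ : ZpExtension ℚ 2) (γ : Field.absoluteGaloisGroup ℚ), κ.IsCyclotomic → κ.IsTopGenerator γ →
      ∀ D : SignedSelmerDualData W κ γ 1, Module.IsTorsion (IwasawaAlgebra 2) D.X ∧ D.mu = 0 := by
  intro κ γ hκ hγ D
  haveI : Module.Finite (IwasawaAlgebra 2) D.X := Kobayashi2003.SignedSelmerDualData.moduleFinite hγ D
  obtain ⟨DA⟩ := nonempty_signedSelmerDualData A κ (1 : ℤˣ) hγ
  obtain ⟨_, hfinA, hXA, hμA, _⟩ := anchorPackage_of_unitZone A hGZK hAr hAss hAa hTam hSha κ γ hκ DA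
  haveI := hfinA
  exact SignedTransportAtTwo.TwoCongruence.isTorsion_and_mu_eq_zero_of_twoCongruence_negDisc
    W hss ha hΔ A hAss hAa e he κ γ hκ D DA hXA hμA

/-- **UNIT-ANCHOR ROAD, UPPER HALF — ONLY K3 AND K4 BY NAME.** `W` non-CM of analytic rank `0`, good supersingular at `2` with `a₂ = 0`, `Δ_W < 0`;
the anchor `A` of analytic rank `0`, good ss at `2` with `a₂ = 0`, in the double unit zone; an equivariant `e : W[2] ≃ A[2]`. From PUB {`hmod`, `hGZK`,
`h2`} and route TP2's OPEN items BY NAME {`hK3 : SignedKatoDivisibilityUpToAtTwo` (20308), `hK4 : SignedControlAtTwo` (20309)}: `MissingUpperBoundAt W 2`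
(Miller's upper bound `ord₂ #Ш(W) ≤ ord₂ #Ш_an(W)`). Chain: `isTorsion_and_mu_eq_zero_of_unitAnchor` (kernel) ⇒ GEN 4's
`signedUpperDivisibility_two_of_katoUpTo_of_mu_eq_zero` on K3 ⇒ `char X⁺_W ∣ ϖ L♭_W` ⇒ lane A's `missingUpperBoundAt_two_of_signedUpperDivisibility_two`
with K4's Kim term. NO `λ`, NO layer certificate, NO item 23110. The two items are hypotheses; a half of BSD₂, not BSD₂; BSD is not proved by any of this.
[cite: Kobayashi2003, Thm. 1.2 and Thm. 4.1] [cite: Kato2004Asterisque, Thm. 12.4–12.5 (3)] [cite: BDKim2013, Cor. 3.15] [cite: AbbesUllmo1996, Thm. A]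
[cite: Washington1997, §7.1 and §13.2] [cite: Miller2011LMS, Def. 1.1] -/
theorem missingUpperBoundAt_two_of_unitAnchor_of_K3K4
    (hmod : nonempty_modularParametrizationData) (hGZK : rank_eq_analyticRank_of_analyticRank_le_one)
    (h2 : realPeriodRat_eq_unit_mul_plusPeriod_two)
    (hK3 : Summit.BirchSwinnertonDyer.BirchSwinnertonDyer.Theses.ThetaPartnerAtTwo.SignedKatoDivisibilityUpToAtTwo)
    (hK4 : Summit.BirchSwinnertonDyer.BirchSwinnertonDyer.Theses.ThetaPartnerAtTwo.SignedControlAtTwo)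
    (hcm : ¬ W.HasCM) (hr : W.analyticRank = 0) (hss : GoodSS W 2) (ha : W.frobeniusTrace 2 = 0) (hΔ : W.Δ < 0)
    (hAr : A.analyticRank = 0) (hAss : GoodSS A 2) (hAa : A.frobeniusTrace 2 = 0)
    (hTam : ¬ 2 ∣ A.tamagawaProduct) (hSha : ¬ 2 ∣ A.shaOrder)
    (e : WeierstrassCurve.geomTorsion W (2 : ℤ) ≃+ WeierstrassCurve.geomTorsion A (2 : ℤ))
    (he : ∀ (σ : Field.absoluteGaloisGroup ℚ) (P : WeierstrassCurve.geomTorsion W (2 : ℤ)), e (σ • P) = σ • e P) :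
    MissingUpperBoundAt W 2 := by
  have hLrat : hasEntireLFunction_rat := WeierstrassCurve.hasEntireLFunction_rat_of_exists_isNewformOf
    (exists_isNewformOf_of_nonempty_modularParametrizationData hmod)
  have hL : W.entireLFunction 1 ≠ 0 := (W.analyticRank_eq_zero_iff_holds (hLrat W)).mp hr
  have hmu := isTorsion_and_mu_eq_zero_of_unitAnchor W A hGZK hss ha hΔ hAr hAss hAa hTam hSha e he
  obtain ⟨_, hKim⟩ := hK4 W hcm hr hss ha
  have h12 : ∀ (κ : ZpExtension ℚ 2) (γ : Field.absoluteGaloisGroup ℚ), κ.IsCyclotomic → κ.IsTopGenerator γ →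
      ∀ D : SignedSelmerDualData W κ γ 1,
        Module.Finite (IwasawaAlgebra 2) D.X ∧ Module.IsTorsion (IwasawaAlgebra 2) D.X :=
    fun κ γ hκ hγ D => ⟨Kobayashi2003.SignedSelmerDualData.moduleFinite hγ D, (hmu κ γ hκ hγ D).1⟩
  exact missingUpperBoundAt_two_of_signedUpperDivisibility_two W hmod hGZK hss.1 ha hL h12 hKim
    (signedUpperDivisibility_two_of_katoUpTo_of_mu_eq_zero W h2 hss (hK3 W hcm hr hss ha) hmu)

end Pair

/-! ## §2 The kit twin on integer models -/

section Door

variable (ME MA : WeierstrassCurve ℤ)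
  [(ME.baseChange ℚ).IsElliptic] [(ME.baseChange ℚ).IsGloballyMinimal]
  [(MA.baseChange ℚ).IsElliptic] [(MA.baseChange ℚ).IsGloballyMinimal]

/-- **KIT DOOR, unit-anchor road, UPPER HALF, only K3/K4 by name.** Integer models `M_E` (non-CM, `L(E,1) ≠ 0`, good ss at `2`, `a₂ = 0`, `Δ < 0`), `M_A`
(the anchor: `L(A,1) ≠ 0`, good ss at `2`, `a₂ = 0`, `2 ∤ ∏c_ℓ`, `2 ∤ #Ш`) and a Tschirnhaus pair `(q, r)` certifying `E[2] ≅ A[2]`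
(`ThetaPartnerXRoute.exists_equivariant_addEquiv_geomTorsion_two_of_tschirnhaus`); PUB (`hmod`, `hGZK`, `h2`) + ITEMS BY NAME (`hK3` 20308, `hK4` 20309)
⟹ `MissingUpperBoundAt (M_E ⊗ ℚ) 2`. The two items are hypotheses; a half of BSD₂; BSD is not proved by any of this.
[cite: Kobayashi2003, Thm. 1.2 and Thm. 4.1] [cite: Kato2004Asterisque, Thm. 12.4–12.5 (3)] [cite: BDKim2013, Cor. 3.15] [cite: AbbesUllmo1996, Thm. A]
[cite: SilvermanAEC2009, III.§1] [cite: Miller2011LMS, Def. 1.1] -/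
theorem missingUpperBoundAt_two_baseChange_int_of_unitAnchor_of_K3K4
    (hmod : nonempty_modularParametrizationData) (hGZK : rank_eq_analyticRank_of_analyticRank_le_one)
    (h2 : realPeriodRat_eq_unit_mul_plusPeriod_two)
    (hK3 : Summit.BirchSwinnertonDyer.BirchSwinnertonDyer.Theses.ThetaPartnerAtTwo.SignedKatoDivisibilityUpToAtTwo)
    (hK4 : Summit.BirchSwinnertonDyer.BirchSwinnertonDyer.Theses.ThetaPartnerAtTwo.SignedControlAtTwo)
    (hcm : ¬ (ME.baseChange ℚ).HasCM) (hL : (ME.baseChange ℚ).entireLFunction 1 ≠ 0)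
    (hss : GoodSS (ME.baseChange ℚ) 2) (ha : (ME.baseChange ℚ).frobeniusTrace 2 = 0) (hΔ : ME.Δ < 0)
    (hLA : (MA.baseChange ℚ).entireLFunction 1 ≠ 0)
    (hAss : GoodSS (MA.baseChange ℚ) 2) (hAa : (MA.baseChange ℚ).frobeniusTrace 2 = 0)
    (hTam : ¬ 2 ∣ (MA.baseChange ℚ).tamagawaProduct) (hSha : ¬ 2 ∣ (MA.baseChange ℚ).shaOrder)
    (q r : ℚ[X])
    (hroot : ∀ ξ : AlgebraicClosure ℚ, Polynomial.aeval ξ (ME.baseChange ℚ).twoTorsionPolynomial.toPoly = 0 →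
      Polynomial.aeval (Polynomial.aeval ξ q) (MA.baseChange ℚ).twoTorsionPolynomial.toPoly = 0)
    (hinv : ∀ ξ : AlgebraicClosure ℚ, Polynomial.aeval ξ (ME.baseChange ℚ).twoTorsionPolynomial.toPoly = 0 →
      Polynomial.aeval (Polynomial.aeval ξ q) r = ξ) :
    MissingUpperBoundAt (ME.baseChange ℚ) 2 := by
  obtain ⟨e, he⟩ := ThetaPartnerXRoute.exists_equivariant_addEquiv_geomTorsion_two_of_tschirnhaus (K := ℚ)
    two_ne_zero (ME.baseChange ℚ) (MA.baseChange ℚ) q r hroot hinv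
  exact missingUpperBoundAt_two_of_unitAnchor_of_K3K4 (ME.baseChange ℚ) (MA.baseChange ℚ) hmod hGZK h2 hK3 hK4 hcm
    (analyticRank_eq_zero_of_entireLFunction_one_ne_zero _ hL) hss ha (by rw [baseChange_int_Δ]; exact_mod_cast hΔ)
    (analyticRank_eq_zero_of_entireLFunction_one_ne_zero _ hLA) hAss hAa hTam hSha e he

end Door

end SSUnitAnchor
end Summit.BirchSwinnertonDyer.BirchSwinnertonDyer.Theorems

end
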